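import Summits.QuantumFields.YangMills.Theorems.ColdExitSC.Negative.UniformExitFalseOfHeavyTwist
import Literature.LinearAlgebra.Matrix.TraceSingularValueInequality
import Literature.MathematicalPhysics.QuantumFieldTheory.BalabanBlockSpecification
import Literature.MathematicalPhysics.QuantumFieldTheory.YangMillsOSNonempty
import Summits.QuantumFields.YangMills.Theorems.LangevinControlUVFemtoCurvatureTwoPointCLatticeStokes
import HarnessLib

/-!
# Crux `IR` (stmt-QuantumFields-19354), line `heavy-twist` (ideator ym-ir-idea-10, lens «negation») — CALIBRATION THEOREM:
# no twist-eater ⇒ the temporal twist is heavy; abelian structure groups have no twist-eater; `U(1)₄` instance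

Helper module for item `stmt-QuantumFields-19354` (`--supports … --as helper`; it closes nothing and touches no registered stub).
Vocabulary: the LANDED core of line `heavy-twist`, `Theorems/ColdExitSC/Negative/UniformExitFalseOfHeavyTwist.lean`
(`twistFactor`, `twistedColdZ`, `twistRatio r c μ β L = Z^{(c)}_β(L³×⌊L/4⌋)/Z_β(L³×⌊L/4⌋)`, `HeavyTwistAt r c μ : ∀ L ≥ 8, r_β(L) → 0`
as `β → ∞`, `PurityTwistBoundAt` = S1 PROVED for every central twist, `EventualImpurityAt`, `UniformExitAtRep`).  The line's one
own stub is S2 `HeavyTwistSU2 = HeavyTwistAt (SU(2) fundamental) (−1) 0` — a finite-dimensional Laplace statement with TWIST-EATERS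
(flat twisted connections exist for `SU(2)`: holonomies a quaternion pair), hence a polynomial rate `β^{−3/2}` and an honest Hessian
computation (critics ym-ir-crit-3 / crit-1: TRUE, PROVABLE, size L–XL).  This file proves the complementary, elementary half of the
picture, for EVERY compact structure group:

* §1–§3 **`heavyTwistAt_of_noEater`**: if on every cold box `L³×⌊L/4⌋`, `L ≥ 8`, the `c`-twisted Wilson action
  `A_c(U) = Σ_x Σ_{μ<ν} (N − Re tr ρ(z_{x,μν} U_{x,μν}))` has NO zero (no twist-eater), then `HeavyTwistAt r c μ`, with the
  EXPONENTIAL bound `0 ≤ r_β(L) ≤ e^{−β m_L/2} / Haar{A_1 < m_L/2}` (`m_L > 0` the action gap: §1 compactness; §2 `Z^{(c)} ≤ e^{−βm}`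
  and `Z ≥ e^{−βs}·Haar{A_1 < s}`, the sub-level set being open and containing the trivial configuration).
* §4 **`twistAction_ne_zero_of_comm`** (abelian Bianchi identity): for an ABELIAN compact `G`, a faithful unitary `ρ` and `c ≠ 1`
  the twisted action has no zero — multiplying the (necessarily trivial) twisted `(0,3)`-plaquette holonomies over the `(0,3)`-plane
  through `(0,0)` gives `c · 1 = 1` (`prod_plane_twistFactor`: exactly one stack plaquette per plane; `prod_plane_plaquette_eq_one`:
  every link enters twice) — hence **`heavyTwistAt_of_comm : c ≠ 1 → HeavyTwistAt r c 0`**, and with S1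
  (`purityTwistBoundAt_of_central`) **`eventualImpurityAt_of_comm`** / **`not_uniformExitAtRep_of_comm`**: every fixed box of an
  abelian theory is eventually `θ`-impure for every `θ < 1/2`, so no β-uniform purity witness exists.
* §5 the `U(1)₄` instance (charge-one compact QED, `LatticeRep.circle`, twist `−1`): `heavyTwistAt_circle`, `not_uniformExitAtRep_circle`.

READING (negative-side calibration, the line's own F5 «the wall is GROUP-BLIND» made a theorem for the `β → ∞` statement S2 itself, not
only for the rung-2 window): the SHAPE `HeavyTwistAt` cannot separate confining from non-confining theories — it HOLDS for `U(1)₄`, where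
it is the elementary fact that a visible magnetic flux `π` through a `2`-torus costs action `> 0` at fixed lattice; what distinguishes
`SU(2)` is that twist-eaters exist (the twist can be screened classically), which only SLOWS the decay of `r_β` to a power law.

HONEST FRAMING.  Nothing here proves S2 `HeavyTwistSU2` (twist-eaters exist for `SU(2)`; this criterion does not apply), nor anything
about `BalabanLadder.IR` (0/1), `IRcof`, confinement, a lattice gap or the Yang–Mills mass gap (Clay), which are NOT proved; `R4` closes
only the conditional finite-𝕋⁴ rung `BalabanLadder.UV`.  `U(1)` is outside the class of `E` (simple simply-connected); §5 refutes no
cell statement.  Width toward IR: 0.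
References: G. 't Hooft, Nucl. Phys. B 153 (1979) 141, §2 (twisted boxes, flux energies); P. de Forcrand, L. von Smekal,
hep-lat/0107018 p. 4 (electric-flux free energies at weak coupling); card `Cruxes/IR/Lines/heavy-twist.md`.
-/

set_option autoImplicit false

noncomputable section

open Filter Topology MeasureTheory
open Literature.MathematicalPhysics.QuantumFieldTheory Literature.MathematicalPhysics.QuantumLattice
open Summit.QuantumFields.YangMills.Theorems.ColdExitSC.Negative.HeavyTwist
open Summit.QuantumFields.YangMills.Theorems.FemtoCurvatureTwoPointC.LatticeStokes (sub_re_trace_map_nonneg)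

namespace Summit.QuantumFields.YangMills.Cruxes.IR.HeavyTwistNoEater

/-! ## §1 The twisted Wilson action of the `Fin` box: non-negativity, continuity, a positive minimum when it has no zero -/

section Action

variable {G : Type} [Group G] [TopologicalSpace G] [IsTopologicalGroup G] [CompactSpace G]
variable {N : ℕ} (ρ : G →* Matrix (Fin N) (Fin N) ℂ)

omit [TopologicalSpace G] [IsTopologicalGroup G] [CompactSpace G] in
/-- A vanishing plaquette term forces the (twisted) plaquette holonomy to be trivial, for a FAITHFUL unitary representation:
`N − Re tr ρ(g) = 0 ⇒ g = 1`. -/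
theorem eq_one_of_term_eq_zero (hρu : ∀ g, ρ g ∈ Matrix.unitaryGroup (Fin N) ℂ) (hρi : Function.Injective ρ)
    {g : G} (h : (N : ℝ) - (ρ g).trace.re = 0) : g = 1 := by
  have htr : RCLike.re (ρ g).trace = Fintype.card (Fin N) := by
    rw [RCLike.re_to_complex, Fintype.card_fin]; linarith
  have h1 : ρ g = 1 := (Literature.LinearAlgebra.Matrix.re_trace_eq_card_iff_of_mem_unitaryGroup (hρu g)).1 htr
  exact hρi (by rw [h1, map_one])

omit [TopologicalSpace G] [IsTopologicalGroup G] [CompactSpace G] in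
/-- The twisted Wilson action `A_z(U) = Σ_x Σ_{μ<ν} (N − Re tr ρ(z-factor · U_{x,μν}))` is non-negative. -/
theorem twistAction_nonneg (hρu : ∀ g, ρ g ∈ Matrix.unitaryGroup (Fin N) ℂ) (z : Fin 4 → G) {n₀ n₁ n₂ n₃ : ℕ}
    (U : FinTorusSite n₀ n₁ n₂ n₃ × Fin 4 → G) :
    0 ≤ ∑ x : FinTorusSite n₀ n₁ n₂ n₃, ∑ q : {q : Fin 4 × Fin 4 // q.1 < q.2},
        ((N : ℝ) - (ρ (twistFactor z x q.1.1 q.1.2 * finTorusPlaquette U x q.1.1 q.1.2)).trace.re) :=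
  Finset.sum_nonneg fun _ _ => Finset.sum_nonneg fun _ _ => sub_re_trace_map_nonneg ρ hρu _

omit [CompactSpace G] in
/-- The twisted Wilson action is a continuous function of the configuration (continuous `ρ`). -/
theorem continuous_twistAction (hρ : Continuous ρ) (z : Fin 4 → G) {n₀ n₁ n₂ n₃ : ℕ} :
    Continuous fun U : FinTorusSite n₀ n₁ n₂ n₃ × Fin 4 → G =>
      ∑ x : FinTorusSite n₀ n₁ n₂ n₃, ∑ q : {q : Fin 4 × Fin 4 // q.1 < q.2},
        ((N : ℝ) - (ρ (twistFactor z x q.1.1 q.1.2 * finTorusPlaquette U x q.1.1 q.1.2)).trace.re) := by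
  have hU : ∀ l : FinTorusSite n₀ n₁ n₂ n₃ × Fin 4,
      Continuous fun U : FinTorusSite n₀ n₁ n₂ n₃ × Fin 4 → G => U l := fun l => continuous_apply l
  have hpl : ∀ (x : FinTorusSite n₀ n₁ n₂ n₃) (μ ν : Fin 4),
      Continuous fun U : FinTorusSite n₀ n₁ n₂ n₃ × Fin 4 → G => finTorusPlaquette U x μ ν := fun x μ ν =>
    (((hU _).mul (hU _)).mul (hU _).inv).mul (hU _).inv
  have htr : Continuous fun g : G => (ρ g).trace.re := Complex.continuous_re.comp (Continuous.matrix_trace hρ)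
  exact continuous_finsetSum _ fun x _ => continuous_finsetSum _ fun q _ =>
    continuous_const.sub (htr.comp (continuous_const.mul (hpl x q.1.1 q.1.2)))

/-- **No twist-eater ⇒ a positive action gap.**  If the twisted action has no zero on the (compact) configuration space, it is
bounded below by a positive constant. -/
theorem exists_pos_le_twistAction (hρ : Continuous ρ) (hρu : ∀ g, ρ g ∈ Matrix.unitaryGroup (Fin N) ℂ) (z : Fin 4 → G)
    {n₀ n₁ n₂ n₃ : ℕ}
    (hne : ∀ U : FinTorusSite n₀ n₁ n₂ n₃ × Fin 4 → G,
      ∑ x : FinTorusSite n₀ n₁ n₂ n₃, ∑ q : {q : Fin 4 × Fin 4 // q.1 < q.2},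
        ((N : ℝ) - (ρ (twistFactor z x q.1.1 q.1.2 * finTorusPlaquette U x q.1.1 q.1.2)).trace.re) ≠ 0) :
    ∃ m : ℝ, 0 < m ∧ ∀ U : FinTorusSite n₀ n₁ n₂ n₃ × Fin 4 → G,
      m ≤ ∑ x : FinTorusSite n₀ n₁ n₂ n₃, ∑ q : {q : Fin 4 × Fin 4 // q.1 < q.2},
        ((N : ℝ) - (ρ (twistFactor z x q.1.1 q.1.2 * finTorusPlaquette U x q.1.1 q.1.2)).trace.re) := by
  obtain ⟨U₀, -, hU₀⟩ := isCompact_univ.exists_isMinOn Set.univ_nonempty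
    (continuous_twistAction ρ hρ z).continuousOn
  refine ⟨_, lt_of_le_of_ne (twistAction_nonneg ρ hρu z U₀) (hne U₀).symm, fun U => ?_⟩
  exact hU₀ (Set.mem_univ U)

end Action

/-! ## §2 Partition-function bounds: `Z^{(z)} ≤ e^{−βm}` under an action gap; `Z ≥ e^{−βs}·Haar{A < s}` -/

section Bounds

variable {G : Type} [Group G] [TopologicalSpace G] [IsTopologicalGroup G] [CompactSpace G]
  [MeasurableSpace G] [BorelSpace G] [SecondCountableTopology G]
variable {N : ℕ} (ρ : G →* Matrix (Fin N) (Fin N) ℂ)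

/-- **Upper bound from an action gap:** if `m ≤ A_z` everywhere and `β ≥ 0` then `Z^{(z)}_β(L³×t) ≤ e^{−βm}`. -/
theorem twistedColdZ_le_exp (hρ : Continuous ρ) {β : ℝ} (hβ : 0 ≤ β) (z : Fin 4 → G) {L t : ℕ} {m : ℝ}
    (hm : ∀ U : FinTorusSite L L L t × Fin 4 → G,
      m ≤ ∑ x : FinTorusSite L L L t, ∑ q : {q : Fin 4 × Fin 4 // q.1 < q.2},
        ((N : ℝ) - (ρ (twistFactor z x q.1.1 q.1.2 * finTorusPlaquette U x q.1.1 q.1.2)).trace.re)) :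
    twistedColdZ ρ β z L t ≤ Real.exp (-(β * m)) := by
  rw [twistedColdZ_eq_integral]
  set μ : Measure (FinTorusSite L L L t × Fin 4 → G) := Measure.pi fun _ => haarProbability G with hμ
  haveI : IsProbabilityMeasure μ := by rw [hμ]; infer_instance
  have hc := continuous_twistAction ρ hρ z (n₀ := L) (n₁ := L) (n₂ := L) (n₃ := t)
  calc ∫ U, Real.exp (-β * ∑ x : FinTorusSite L L L t, ∑ q : {q : Fin 4 × Fin 4 // q.1 < q.2},
          ((N : ℝ) - (ρ (twistFactor z x q.1.1 q.1.2 * finTorusPlaquette U x q.1.1 q.1.2)).trace.re)) ∂μ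
      ≤ ∫ _U, Real.exp (-(β * m)) ∂μ := by
        refine integral_mono ((Real.continuous_exp.comp (continuous_const.mul hc)).integrable_of_hasCompactSupport
          (IsCompact.of_isClosed_subset isCompact_univ (isClosed_tsupport _) (Set.subset_univ _)))
          (integrable_const _) fun U => ?_
        exact Real.exp_le_exp.2 (by nlinarith [hm U])
    _ = Real.exp (-(β * m)) := by simp

/-- **Lower bound from a sub-level set:** for `β ≥ 0`, `Z_β(L³×t) ≥ e^{−βs} · Haar{U : A(U) < s}` (untwisted action `A = A_1`). -/
theorem exp_mul_measure_le_wilsonFinTorusPartition (hρ : Continuous ρ) {β : ℝ} (hβ : 0 ≤ β) {L t : ℕ} (s : ℝ) :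
    Real.exp (-(β * s)) *
        ((Measure.pi fun _ : FinTorusSite L L L t × Fin 4 => haarProbability G)
          {U | ∑ x : FinTorusSite L L L t, ∑ q : {q : Fin 4 × Fin 4 // q.1 < q.2},
            ((N : ℝ) - (ρ (twistFactor 1 x q.1.1 q.1.2 * finTorusPlaquette U x q.1.1 q.1.2)).trace.re) < s}).toReal ≤
      wilsonFinTorusPartition ρ β L L L t := by
  rw [← twistedColdZ_one, twistedColdZ_eq_integral]
  set μ : Measure (FinTorusSite L L L t × Fin 4 → G) := Measure.pi fun _ => haarProbability G with hμ
  haveI : IsProbabilityMeasure μ := by rw [hμ]; infer_instance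
  set A : (FinTorusSite L L L t × Fin 4 → G) → ℝ := fun U =>
    ∑ x : FinTorusSite L L L t, ∑ q : {q : Fin 4 × Fin 4 // q.1 < q.2},
      ((N : ℝ) - (ρ (twistFactor 1 x q.1.1 q.1.2 * finTorusPlaquette U x q.1.1 q.1.2)).trace.re) with hA
  have hc : Continuous A := continuous_twistAction ρ hρ 1
  have hS : MeasurableSet {U | A U < s} := (isOpen_lt hc continuous_const).measurableSet
  have hind : ∀ U, Real.exp (-(β * s)) * Set.indicator {U | A U < s} (fun _ => (1 : ℝ)) U ≤ Real.exp (-β * A U) := by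
    intro U
    by_cases hU : U ∈ {U | A U < s}
    · rw [Set.indicator_of_mem hU, mul_one]
      exact Real.exp_le_exp.2 (by have := hU; simp only [Set.mem_setOf_eq] at this; nlinarith)
    · rw [Set.indicator_of_notMem hU, mul_zero]
      exact (Real.exp_pos _).le
  calc Real.exp (-(β * s)) * (μ {U | A U < s}).toReal
      = ∫ U, Real.exp (-(β * s)) * Set.indicator {U | A U < s} (fun _ => (1 : ℝ)) U ∂μ := by
        rw [integral_const_mul, integral_indicator_const _ hS, smul_eq_mul, mul_one, Measure.real]
    _ ≤ ∫ U, Real.exp (-β * A U) ∂μ := by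
        refine integral_mono ?_ ((Real.continuous_exp.comp (continuous_const.mul hc)).integrable_of_hasCompactSupport
          (IsCompact.of_isClosed_subset isCompact_univ (isClosed_tsupport _) (Set.subset_univ _))) hind
        exact (integrable_const _).indicator hS |>.const_mul _
    _ = _ := by rfl

omit [SecondCountableTopology G] in
/-- The sub-level sets `{A < s}`, `s > 0`, of the untwisted action have positive Haar measure (they are open and contain the
trivial configuration). -/
theorem measure_actionBelow_pos (hρ : Continuous ρ) {L t : ℕ} {s : ℝ} (hs : 0 < s) :
    0 < ((Measure.pi fun _ : FinTorusSite L L L t × Fin 4 => haarProbability G)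
          {U | ∑ x : FinTorusSite L L L t, ∑ q : {q : Fin 4 × Fin 4 // q.1 < q.2},
            ((N : ℝ) - (ρ (twistFactor 1 x q.1.1 q.1.2 * finTorusPlaquette U x q.1.1 q.1.2)).trace.re) < s}).toReal := by
  haveI : (haarProbability G).IsOpenPosMeasure := by
    dsimp [haarProbability]; infer_instance
  haveI : IsProbabilityMeasure (haarProbability G) := inferInstance
  set A : (FinTorusSite L L L t × Fin 4 → G) → ℝ := fun U =>
    ∑ x : FinTorusSite L L L t, ∑ q : {q : Fin 4 × Fin 4 // q.1 < q.2},
      ((N : ℝ) - (ρ (twistFactor 1 x q.1.1 q.1.2 * finTorusPlaquette U x q.1.1 q.1.2)).trace.re) with hA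
  have hc : Continuous A := continuous_twistAction ρ hρ (1 : Fin 4 → G)
  have hopen : IsOpen {U | A U < s} := isOpen_lt hc continuous_const
  have hmem : (fun _ : FinTorusSite L L L t × Fin 4 => (1 : G)) ∈ {U | A U < s} := by
    simp only [Set.mem_setOf_eq, hA, twistFactor_one, one_mul, finTorusPlaquette, mul_inv_cancel, map_one,
      Matrix.trace_one, Fintype.card_fin, Complex.natCast_re, sub_self, Finset.sum_const_zero]
    exact hs
  exact ENNReal.toReal_pos (hopen.measure_pos _ ⟨_, hmem⟩).ne' (measure_lt_top _ _).ne

end Bounds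

/-! ## §3 No twist-eater ⇒ heavy twist -/

section NoEater

variable {G : Type} [Group G] [TopologicalSpace G] [IsTopologicalGroup G] [CompactSpace G]
  [MeasurableSpace G] [BorelSpace G]

/-- **No twist-eater ⇒ the twist is heavy (exponentially).**  For every compact `G`, every lattice representation `r`, every `c`
and direction `μ`: if on every cold box `L³ × ⌊L/4⌋`, `L ≥ 8`, the `c`-twisted Wilson action has NO zero (no configuration with all
untwisted plaquettes trivial and all stack plaquettes equal to `c⁻¹` — no "twist-eater"), then `r_β(L) → 0` as `β → ∞` for every
`L ≥ 8`, i.e. `HeavyTwistAt r c μ`.  Quantitatively `0 ≤ r_β(L) ≤ e^{−βm_L/2} / Haar{A < m_L/2}` with `m_L > 0` the action gap. -/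
theorem heavyTwistAt_of_noEater (r : LatticeRep G) (c : G) (μ : Fin 4)
    (hne : ∀ L : ℕ, 8 ≤ L → ∀ U : FinTorusSite L L L (L / 4) × Fin 4 → G,
      ∑ x : FinTorusSite L L L (L / 4), ∑ q : {q : Fin 4 × Fin 4 // q.1 < q.2},
        ((r.N : ℝ) - (r.ρ (twistFactor (Function.update 1 μ c) x q.1.1 q.1.2 *
          finTorusPlaquette U x q.1.1 q.1.2)).trace.re) ≠ 0) :
    HeavyTwistAt r c μ := by
  haveI : SecondCountableTopology G := r.secondCountableTopology
  intro L hL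
  obtain ⟨m, hm0, hm⟩ := exists_pos_le_twistAction r.ρ r.continuous r.mem_unitary (Function.update 1 μ c) (hne L hL)
  set v : ℝ := ((Measure.pi fun _ : FinTorusSite L L L (L / 4) × Fin 4 => haarProbability G)
    {U | ∑ x : FinTorusSite L L L (L / 4), ∑ q : {q : Fin 4 × Fin 4 // q.1 < q.2},
      ((r.N : ℝ) - (r.ρ (twistFactor 1 x q.1.1 q.1.2 * finTorusPlaquette U x q.1.1 q.1.2)).trace.re) < m / 2}).toReal
    with hv
  have hv0 : 0 < v := measure_actionBelow_pos r.ρ r.continuous (half_pos hm0)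
  -- squeeze: `0 ≤ r_β ≤ e^{−βm/2}/v` for `β ≥ 0`
  have hup : Tendsto (fun β : ℝ => Real.exp (-(β * (m / 2))) / v) atTop (𝓝 0) := by
    have h1 : Tendsto (fun β : ℝ => -(β * (m / 2))) atTop atBot := by
      have := (tendsto_id.atTop_mul_const (half_pos hm0))
      exact tendsto_neg_atTop_atBot.comp this
    have h2 := Real.tendsto_exp_atBot.comp h1
    simpa using h2.div_const v
  refine tendsto_of_tendsto_of_tendsto_of_le_of_le' tendsto_const_nhds hup ?_ ?_
  · filter_upwards [eventually_ge_atTop (0 : ℝ)] with β hβ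
    exact div_nonneg (by rw [twistedColdZ_eq_integral]; exact integral_nonneg fun U => (Real.exp_pos _).le)
      (wilsonFinTorusPartition_pos r.continuous β L L L (L / 4)).le
  · filter_upwards [eventually_ge_atTop (0 : ℝ)] with β hβ
    have hZpos := wilsonFinTorusPartition_pos (ρ := r.ρ) r.continuous β L L L (L / 4)
    have hnum := twistedColdZ_le_exp r.ρ r.continuous hβ (Function.update 1 μ c) hm
    have hden := exp_mul_measure_le_wilsonFinTorusPartition r.ρ r.continuous hβ (L := L) (t := L / 4) (m / 2)
    rw [← hv] at hden
    unfold twistRatio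
    rw [div_le_div_iff₀ hZpos hv0]
    calc twistedColdZ r.ρ β (Function.update 1 μ c) L (L / 4) * v ≤ Real.exp (-(β * m)) * v :=
          mul_le_mul_of_nonneg_right hnum hv0.le
      _ = Real.exp (-(β * (m / 2))) * (Real.exp (-(β * (m / 2))) * v) := by
          rw [← mul_assoc, ← Real.exp_add]; ring_nf
      _ ≤ Real.exp (-(β * (m / 2))) * wilsonFinTorusPartition r.ρ β L L L (L / 4) :=
          mul_le_mul_of_nonneg_left hden (Real.exp_pos _).le

end NoEater


/-! ## §4 Abelian structure groups have no twist-eaters (abelian Bianchi identity on one twisted plane) -/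

section Abelian

variable {G : Type} [CommGroup G] [TopologicalSpace G] [IsTopologicalGroup G] [CompactSpace G]

omit [TopologicalSpace G] [IsTopologicalGroup G] [CompactSpace G] in
/-- **Abelian Bianchi identity on a twisted plane:** for an abelian structure group the product of the `(0,3)`-plaquette holonomies over
the `(0,3)`-plane through the transverse position `(a, b)` of the box `L³ × t` is `1` (every link of the plane enters twice with
opposite orientations; the shifts are permutations of the plane). -/
theorem prod_plane_plaquette_eq_one {L t : ℕ} (U : FinTorusSite L L L t × Fin 4 → G) (a b : Fin L) :
    ∏ ik : Fin L × Fin t, finTorusPlaquette U ((ik.1, a, b, ik.2) : FinTorusSite L L L t) 0 3 = 1 := by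
  have hsh0 : ∀ (i : Fin L) (k : Fin t),
      FinTorusSite.shift ((i, a, b, k) : FinTorusSite L L L t) 0 = (finRotate L i, a, b, k) := by
    intro i k; simp [FinTorusSite.shift]
  have hsh3 : ∀ (i : Fin L) (k : Fin t),
      FinTorusSite.shift ((i, a, b, k) : FinTorusSite L L L t) 3 = (i, a, b, finRotate t k) := by
    intro i k; simp [FinTorusSite.shift]
  simp only [finTorusPlaquette, hsh0, hsh3, Finset.prod_mul_distrib, Finset.prod_inv_distrib]
  have h1 : ∏ ik : Fin L × Fin t, U ((finRotate L ik.1, a, b, ik.2), (3 : Fin 4)) =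
      ∏ ik : Fin L × Fin t, U ((ik.1, a, b, ik.2), (3 : Fin 4)) :=
    Fintype.prod_equiv (Equiv.prodCongr (finRotate L) (Equiv.refl _)) _ _ (fun _ => rfl)
  have h2 : ∏ ik : Fin L × Fin t, U ((ik.1, a, b, finRotate t ik.2), (0 : Fin 4)) =
      ∏ ik : Fin L × Fin t, U ((ik.1, a, b, ik.2), (0 : Fin 4)) :=
    Fintype.prod_equiv (Equiv.prodCongr (Equiv.refl _) (finRotate t)) _ _ (fun _ => rfl)
  rw [h1, h2, mul_comm (∏ ik : Fin L × Fin t, U ((ik.1, a, b, ik.2), (0 : Fin 4)))]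
  group

omit [TopologicalSpace G] [IsTopologicalGroup G] [CompactSpace G] in
/-- On the `(0,3)`-plane through `(a, b)` exactly ONE plaquette carries the temporal twist `c` (the one at `x₀ = x₃ = 0`), so the
product of the twist factors over the plane is `c`. -/
theorem prod_plane_twistFactor {L t : ℕ} [NeZero L] [NeZero t] (c : G) (a b : Fin L) :
    ∏ ik : Fin L × Fin t, twistFactor (Function.update 1 0 c) ((ik.1, a, b, ik.2) : FinTorusSite L L L t) 0 3 = c := by
  have key : ∀ ik : Fin L × Fin t,
      twistFactor (Function.update 1 0 c) ((ik.1, a, b, ik.2) : FinTorusSite L L L t) 0 3 =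
        if ik = (0, 0) then c else 1 := by
    rintro ⟨i, k⟩
    simp only [twistFactor, siteCoord, Function.update_self, Matrix.cons_val_zero, Prod.mk.injEq, Fin.ext_iff,
      Fin.val_zero, true_and]
    have h3 : (![(i : ℕ), (a : ℕ), (b : ℕ), (k : ℕ)] : Fin 4 → ℕ) 3 = (k : ℕ) := rfl
    simp only [h3, and_comm]
  simp_rw [key]
  simp

omit [TopologicalSpace G] [IsTopologicalGroup G] [CompactSpace G] in
/-- **No twist-eater for abelian structure groups.**  For an abelian compact `G`, a faithful unitary `ρ`, a twist `c ≠ 1` in the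
`(0,3)`-planes and a non-degenerate box (`L, t ≥ 1`), the twisted Wilson action has NO zero: if every plaquette term vanished, every
twisted plaquette holonomy would be trivial, and multiplying them over the `(0,3)`-plane through `(0,0)` gives `c · 1 = 1` by the
abelian Bianchi identity — contradicting `c ≠ 1`. -/
theorem twistAction_ne_zero_of_comm {N : ℕ} (ρ : G →* Matrix (Fin N) (Fin N) ℂ)
    (hρu : ∀ g, ρ g ∈ Matrix.unitaryGroup (Fin N) ℂ) (hρi : Function.Injective ρ) {c : G} (hc : c ≠ 1)
    {L t : ℕ} [NeZero L] [NeZero t] (U : FinTorusSite L L L t × Fin 4 → G) :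
    ∑ x : FinTorusSite L L L t, ∑ q : {q : Fin 4 × Fin 4 // q.1 < q.2},
      ((N : ℝ) - (ρ (twistFactor (Function.update 1 0 c) x q.1.1 q.1.2 * finTorusPlaquette U x q.1.1 q.1.2)).trace.re) ≠ 0 := by
  intro h0
  have h1 := (Finset.sum_eq_zero_iff_of_nonneg (fun x _ =>
    Finset.sum_nonneg fun q _ => sub_re_trace_map_nonneg ρ hρu
      (twistFactor (Function.update 1 0 c) x q.1.1 q.1.2 * finTorusPlaquette U x q.1.1 q.1.2))).1 h0
  have hone : ∀ x : FinTorusSite L L L t,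
      twistFactor (Function.update 1 0 c) x 0 3 * finTorusPlaquette U x 0 3 = 1 := by
    intro x
    have h2 := (Finset.sum_eq_zero_iff_of_nonneg (fun q _ => sub_re_trace_map_nonneg ρ hρu
      (twistFactor (Function.update 1 0 c) x q.1.1 q.1.2 * finTorusPlaquette U x q.1.1 q.1.2))).1
      (h1 x (Finset.mem_univ x))
    exact eq_one_of_term_eq_zero ρ hρu hρi (h2 ⟨((0 : Fin 4), (3 : Fin 4)), by decide⟩ (Finset.mem_univ _))
  have hprod : ∏ ik : Fin L × Fin t,
      (twistFactor (Function.update 1 0 c) ((ik.1, (0 : Fin L), (0 : Fin L), ik.2) : FinTorusSite L L L t) 0 3 *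
        finTorusPlaquette U ((ik.1, (0 : Fin L), (0 : Fin L), ik.2) : FinTorusSite L L L t) 0 3) = 1 :=
    Finset.prod_eq_one fun ik _ => hone _
  rw [Finset.prod_mul_distrib, prod_plane_twistFactor, prod_plane_plaquette_eq_one, mul_one] at hprod
  exact hc hprod

variable [MeasurableSpace G] [BorelSpace G]

/-- **The temporal twist of an ABELIAN theory is heavy:** for every abelian compact `G`, every lattice representation `r` and every
`c ≠ 1`, `HeavyTwistAt r c 0` — at every fixed box `L ≥ 8` the twist ratio `Z^{(c)}_β(L³×⌊L/4⌋)/Z_β(L³×⌊L/4⌋) → 0` as `β → ∞`,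
exponentially fast (no twist-eater ⇒ positive action gap).  So the SHAPE of `S2 = HeavyTwistSU2` is group-blind: it holds for
`U(1)₄` (where it is the elementary statement that visible magnetic flux costs energy); what is special about `SU(2)` is only that
twist-eaters EXIST there (the flat twisted connections with holonomies a quaternion pair), which makes `S2` a polynomial-rate
Laplace statement instead of an exponential one. -/
theorem heavyTwistAt_of_comm (r : LatticeRep G) {c : G} (hc : c ≠ 1) : HeavyTwistAt r c 0 := by
  refine heavyTwistAt_of_noEater r c 0 fun L hL U => ?_
  haveI : NeZero L := ⟨by omega⟩
  haveI : NeZero (L / 4) := ⟨by omega⟩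
  exact twistAction_ne_zero_of_comm r.ρ r.mem_unitary r.injective hc U

/-- **Eventual `θ`-impurity of every fixed abelian box, `θ < 1/2`** (S1 for the central `c` — every element is central — is the tree
theorem `purityTwistBoundAt_of_central`; S2 is `heavyTwistAt_of_comm`). -/
theorem eventualImpurityAt_of_comm (r : LatticeRep G) {c : G} (hc : c ≠ 1) {θ : ℝ} (hθ : θ < 1 / 2) :
    EventualImpurityAt r θ :=
  eventualImpurityAt_of_heavyTwist r
    (purityTwistBoundAt_of_central r (Subgroup.mem_center_iff.2 fun g => mul_comm g c) 0)
    (heavyTwistAt_of_comm r hc) hθ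

/-- Hence **no β-uniform pure box** in an abelian theory with a non-trivial structure group: `¬ UniformExitAtRep r θ` for `θ < 1/2`. -/
theorem not_uniformExitAtRep_of_comm (r : LatticeRep G) {c : G} (hc : c ≠ 1) {θ : ℝ} (hθ : θ < 1 / 2) :
    ¬ UniformExitAtRep r θ :=
  not_uniformExitAtRep r (eventualImpurityAt_of_comm r hc hθ)

end Abelian

/-! ## §5 The `U(1)₄` instance: the `ℤ₂`-valued temporal twist `−1` of compact QED is heavy -/

/-- `−1 ≠ 1` in `U(1)`. -/
theorem neg_one_ne_one_circle : (-1 : Circle) ≠ 1 := by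
  intro h
  have h' : ((-1 : Circle) : ℂ) = ((1 : Circle) : ℂ) := by rw [h]
  norm_num at h'

/-- **`U(1)₄`: the temporal twist by `−1` is heavy** — `HeavyTwistAt LatticeRep.circle (−1) 0` (charge-one compact QED; the twisted
action has no zero because a visible flux `π` through a `2`-torus cannot be carried by flat plaquettes). -/
theorem heavyTwistAt_circle :
    letI : MeasurableSpace Circle := borel Circle
    haveI : BorelSpace Circle := ⟨rfl⟩
    HeavyTwistAt LatticeRep.circle (-1) 0 := by
  letI : MeasurableSpace Circle := borel Circle
  haveI : BorelSpace Circle := ⟨rfl⟩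
  exact heavyTwistAt_of_comm LatticeRep.circle neg_one_ne_one_circle

/-- **`U(1)₄`: every fixed cold box is eventually `θ`-impure for every `θ < 1/2`, hence admits no β-uniform purity witness.** -/
theorem not_uniformExitAtRep_circle {θ : ℝ} (hθ : θ < 1 / 2) :
    letI : MeasurableSpace Circle := borel Circle
    haveI : BorelSpace Circle := ⟨rfl⟩
    EventualImpurityAt LatticeRep.circle θ ∧ ¬ UniformExitAtRep LatticeRep.circle θ := by
  letI : MeasurableSpace Circle := borel Circle
  haveI : BorelSpace Circle := ⟨rfl⟩
  exact ⟨eventualImpurityAt_of_comm LatticeRep.circle neg_one_ne_one_circle hθ,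
    not_uniformExitAtRep_of_comm LatticeRep.circle neg_one_ne_one_circle hθ⟩

end Summit.QuantumFields.YangMills.Cruxes.IR.HeavyTwistNoEater

end
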